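import Summits.CriticalPhenomena.PercolationContinuityZ3.Theorems.PercNearOneGluingNoHeavyLowerTailFKHullPortTADefs
import Summits.CriticalPhenomena.PercolationContinuityZ3.Theorems.PercNearOneGluingNoHeavyLowerTailCSHUnfoldOneTools
import Literature.Probability.Percolation.TwoSetConditionalAssociationRC
import HarnessLib

/-!
# FK sub-lane: Lemma U_FK, file 1 — WORLD COVARIANCES for `φ_{w,q}` (sum level): linear algebra, the Markov merge at `C_Y`,
# and the orthogonality of `C_Y`-measurable terms to the residual

Support / definitions file (`--supports stmt-CriticalPhenomena-4575`), FK sub-lane `prim-bschramm-fk-1` (gen 2) of the post-continuity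
programme; builds on p205010 (kernel theorem, internal audit signed; external expert review pending).  No named facts, no sorries;
standard axioms.  First file of the port plan bschramm/FK-DEFS.md §6.3 (Lemma U for the random-cluster measure): prim-ineq-prove-1's
`…NoHeavyLowerTailCSHUnfoldOneTools.lean` §"World covariances" / "Step C" with the two FK substitutions
`weight ŵ ↦ rcMass w q` and `wmeanOff ŵ Y φ ζ = Σ_η weight(η) φ(η ∖ cut) ↦ FK.wE w q (cut Y ζ) φ = Σ_η rcMass (delW w (cut Y ζ)) q η · φ η`
(van den Berg–Häggström–Kahn's Lemma 2.3 for `φ_{𝐩,q}`: the world deletes the pairs meeting the open vertex cluster of `Y`, same `q`).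

* `FK.wcov w q Y φ ψ ζ` — the world covariance `Cov_{φ_{G − cut_Y(ζ), q}}(φ, ψ)`;
* `FK.wcov_eq_sum`, `FK.wcov_lin`, `FK.wcov_lin₂` — linear algebra (any `q > 0`);
* `FK.markov_merge_Y_rc` — **Markov merge at `C_Y`**: `Σ_ω m(ω) 1_D(ω) Σ_η m^ω(η) (g(C_x η) − ḡ(ω)) ψ(η) = Σ_ζ m(ζ) 1_D(ζ) (g(C_x ζ) − ḡ(ζ)) ψ(ζ ∖ cut_Y ζ)`
  (`m = rcMass w q`, `m^ω = rcMass (delW w (cut Y ω)) q`, `D = {x ↮ Y}`, `ḡ(ω) = FK.wE w q (cut Y ω) (g ∘ C_x)`), from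
  `BHK2006.rcMass_sum_setCl_eq` class by class;
* `FK.residual_orthogonal_rc` — for any function `κ` of the cluster of `Y`, `Σ_ζ m(ζ) 1_D(ζ) κ(C_Y ζ) (g(C_x ζ) − ḡ(ζ)) = 0`.
[cite: VandenbergHaggstromKahn2005, §2.1 Lemmas 2.3–2.4 (p. 10)] [cite: Grimmett2006, §1.4 eq. (1.20) (p. 15)]
-/

noncomputable section

namespace Summit.CriticalPhenomena.PercolationContinuityZ3.Theorems

open MeasureTheory Set Literature.Probability.LatticeModels Literature.Probability.Percolation
open scoped Classical
open BHK2006 DecisionTree HullPort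

namespace FK

variable {V : Type*} [Fintype V]

/-! ### World covariances for `φ_{w,q}` -/

/-- The world covariance `Cov_{φ_{G − cut_Y(ζ), q}}(φ, ψ) = ḡ(φψ) − ḡ(φ)ḡ(ψ)` (sum level; the world deletes the pairs meeting the open
vertex cluster of `Y` in `ζ`, same `q`; `CSH.wcovOff` with the FK world expectation `FK.wE`).
(transcription of the cell memo prim-hp-8 PROOF-S5-ALL-R.md §3.1, FK worlds) [cite: VandenbergHaggstromKahn2005, §2.1 Lemma 2.3 (p. 10)] -/
def wcov (w : Sym2 V → unitInterval) (q : ℝ) (Y : Set V) (φ ψ : Set (Sym2 V) → ℝ) (ζ : Set (Sym2 V)) : ℝ :=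
  wE w q (cut Y ζ) (fun β => φ β * ψ β) - wE w q (cut Y ζ) φ * wE w q (cut Y ζ) ψ

/-- `Σ_η m^B(η) = 1` for the world masses (`q > 0`). [cite: Grimmett2006, §1.4 eq. (1.20) (p. 15)] -/
theorem wE_one (w : Sym2 V → unitInterval) {q : ℝ} (hq : 0 < q) (B : Set (Sym2 V)) : wE w q B (fun _ => (1 : ℝ)) = 1 := by
  simp only [wE, mul_one]
  exact sum_rcMass _ hq

/-- The world covariance as `Σ_η m^ω(η) (φ(η) − ḡ(φ))·ψ(η)`. [folklore] -/
theorem wcov_eq_sum (w : Sym2 V → unitInterval) (q : ℝ) (Y : Set V) (φ ψ : Set (Sym2 V) → ℝ) (ζ : Set (Sym2 V)) :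
    wcov w q Y φ ψ ζ = ∑ η, rcMass (delW w (cut Y ζ)) q η * ((φ η - wE w q (cut Y ζ) φ) * ψ η) := by
  have e : ∀ η, rcMass (delW w (cut Y ζ)) q η * ((φ η - wE w q (cut Y ζ) φ) * ψ η) =
      rcMass (delW w (cut Y ζ)) q η * (φ η * ψ η) - wE w q (cut Y ζ) φ * (rcMass (delW w (cut Y ζ)) q η * ψ η) := by
    intro η; ring
  rw [Finset.sum_congr rfl (fun η _ => e η), Finset.sum_sub_distrib, ← Finset.mul_sum]
  rfl

/-- The world covariance is linear in the second slot and kills constants (`q > 0`):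
`Cov(φ, c₁ψ₁ − c₀ − ψ₂) = c₁Cov(φ,ψ₁) − Cov(φ,ψ₂)`. [folklore] -/
theorem wcov_lin (w : Sym2 V → unitInterval) {q : ℝ} (hq : 0 < q) (Y : Set V) (φ ψ₁ ψ₂ : Set (Sym2 V) → ℝ) (c₁ c₀ : ℝ)
    (ζ : Set (Sym2 V)) :
    wcov w q Y φ (fun β => c₁ * ψ₁ β - c₀ - ψ₂ β) ζ = c₁ * wcov w q Y φ ψ₁ ζ - wcov w q Y φ ψ₂ ζ := by
  rw [wcov_eq_sum, wcov_eq_sum, wcov_eq_sum]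
  set B := cut Y ζ with hB
  have hm : ∑ η, rcMass (delW w B) q η = 1 := sum_rcMass _ hq
  have h0 : ∑ η, rcMass (delW w B) q η * ((φ η - wE w q B φ) * c₀) = 0 := by
    have e0 : ∀ η, rcMass (delW w B) q η * ((φ η - wE w q B φ) * c₀) =
        c₀ * (rcMass (delW w B) q η * φ η) - c₀ * wE w q B φ * rcMass (delW w B) q η := by intro η; ring
    rw [Finset.sum_congr rfl (fun η _ => e0 η), Finset.sum_sub_distrib, ← Finset.mul_sum, ← Finset.mul_sum, hm]
    unfold wE; ring
  have e : ∀ η, rcMass (delW w B) q η * ((φ η - wE w q B φ) * (c₁ * ψ₁ η - c₀ - ψ₂ η)) =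
      c₁ * (rcMass (delW w B) q η * ((φ η - wE w q B φ) * ψ₁ η)) -
        rcMass (delW w B) q η * ((φ η - wE w q B φ) * c₀) -
        rcMass (delW w B) q η * ((φ η - wE w q B φ) * ψ₂ η) := by intro η; ring
  rw [Finset.sum_congr rfl (fun η _ => e η), Finset.sum_sub_distrib, Finset.sum_sub_distrib, ← Finset.mul_sum, h0, sub_zero]

/-- The world covariance is linear in the second slot: `Cov(φ, αψ − βχ) = αCov(φ,ψ) − βCov(φ,χ)`. [folklore] -/
theorem wcov_lin₂ (w : Sym2 V → unitInterval) (q : ℝ) (Y : Set V) (φ ψ χ : Set (Sym2 V) → ℝ) (α β : ℝ) (ζ : Set (Sym2 V)) :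
    wcov w q Y φ (fun η => α * ψ η - β * χ η) ζ = α * wcov w q Y φ ψ ζ - β * wcov w q Y φ χ ζ := by
  rw [wcov_eq_sum, wcov_eq_sum, wcov_eq_sum, Finset.mul_sum, Finset.mul_sum, ← Finset.sum_sub_distrib]
  exact Finset.sum_congr rfl fun η _ => by ring

/-- The world covariance commutes with finite sums in the second slot. [folklore] -/
theorem wcov_finset_sum {ι : Type*} (w : Sym2 V → unitInterval) (q : ℝ) (Y : Set V) (φ : Set (Sym2 V) → ℝ) (s : Finset ι)
    (ψ : ι → Set (Sym2 V) → ℝ) (ζ : Set (Sym2 V)) :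
    wcov w q Y φ (fun η => ∑ i ∈ s, ψ i η) ζ = ∑ i ∈ s, wcov w q Y φ (ψ i) ζ := by
  simp only [wcov_eq_sum]
  rw [Finset.sum_comm]
  refine Finset.sum_congr rfl fun η _ => ?_
  rw [Finset.mul_sum, Finset.mul_sum]

/-! ### The Markov merge at `C_Y` and the orthogonality of `C_Y`-measurable terms (rc Lemma 2.3, class by class) -/

/-- The indicator of `{x ↮ Y}` as a function of the cluster of `Y`. [folklore] -/
theorem ind_avoidEv_eq_ite_setCl (x : V) (Y : Set V) (ζ : Set (Sym2 V)) :
    ind (avoidEv x Y) ζ = (if (x ∈ Y ∨ ∃ e ∈ setCl ζ Y, x ∈ e) then (0 : ℝ) else 1) := by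
  by_cases h : (x ∈ Y ∨ ∃ e ∈ setCl ζ Y, x ∈ e)
  · rw [if_pos h, ind_of_not_mem (fun h' => (CSH.mem_avoidEv_iff_notMem_span x Y ζ).1 h' h)]
  · rw [if_neg h, ind_of_mem ((CSH.mem_avoidEv_iff_notMem_span x Y ζ).2 h)]

/-- **Markov merge at `C_Y` for `φ_{w,q}`** (`q > 0`).  For any world test function `ψ`:
`Σ_ω m(ω) 1_D(ω) Σ_η m^ω(η) (g(C_x η) − ḡ(ω)) ψ(η) = Σ_ζ m(ζ) 1_D(ζ) (g(C_x ζ) − ḡ(ζ)) ψ(ζ ∖ cut_Y ζ)`, `m = rcMass w q`,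
`m^ω = rcMass (delW w (cut_Y ω)) q`, `ḡ(ω) = E_{φ_{G − cut_Y(ω), q}}[g(C_x)]` (van den Berg–Häggström–Kahn's Lemma 2.3 for the random-cluster
measure, `BHK2006.rcMass_sum_setCl_eq`, read backwards; on `D = {x ↮ Y}` the cluster of `x` off the cut is the cluster of `x`).
(`CSH.markov_merge_Y` for `φ_{w,q}`) [cite: VandenbergHaggstromKahn2005, §2.1 Lemma 2.3–2.4 (p. 10) — corollary] -/
theorem markov_merge_Y_rc (w : Sym2 V → unitInterval) {q : ℝ} (hq : 0 < q) (x : V) (Y : Set V) (g : Set (Sym2 V) → ℝ)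
    (ψ : Set (Sym2 V) → ℝ) :
    ∑ ω, rcMass w q ω * (ind (avoidEv x Y) ω *
        ∑ η, rcMass (delW w (cut Y ω)) q η * ((g (openEdgeCluster η x) -
          wE w q (cut Y ω) (fun β => g (openEdgeCluster β x))) * ψ η)) =
      ∑ ζ, rcMass w q ζ * (ind (avoidEv x Y) ζ *
        ((g (openEdgeCluster ζ x) - wE w q (cut Y ζ) (fun β => g (openEdgeCluster β x))) * ψ (ζ \ cut Y ζ))) := by
  classical
  -- kernel: K(W, β) = 1{x ∉ Y ∪ V(W)} · (g(C_x β) − ḡ_W) · ψ(β), ḡ_W = E_{G − barOf Y W}[g(C_x)]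
  set mW : Set (Sym2 V) → ℝ := fun W => wE w q (barOf Y W) (fun β => g (openEdgeCluster β x)) with hmW
  set χ : Set (Sym2 V) → ℝ := fun W => if (x ∈ Y ∨ ∃ e ∈ W, x ∈ e) then 0 else 1 with hχ
  set K : Set (Sym2 V) → Set (Sym2 V) → ℝ := fun W β => χ W * ((g (openEdgeCluster β x) - mW W) * ψ β) with hK
  have hmean : ∀ ζ : Set (Sym2 V), wE w q (cut Y ζ) (fun β => g (openEdgeCluster β x)) = mW (setCl ζ Y) := by
    intro ζ; simp only [hmW, cut_eq_barOf]
  -- both sides as sums over the classes `{setCl · Y = W}`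
  have hL : ∀ ω, rcMass w q ω * (ind (avoidEv x Y) ω *
      ∑ η, rcMass (delW w (cut Y ω)) q η * ((g (openEdgeCluster η x) -
        wE w q (cut Y ω) (fun β => g (openEdgeCluster β x))) * ψ η)) =
      ∑ W : Set (Sym2 V), (if setCl ω Y = W then rcMass w q ω * ∑ η, rcMass (delW w (barOf Y W)) q η * K W η else 0) := by
    intro ω
    rw [Fintype.sum_ite_eq (setCl ω Y) (fun W => rcMass w q ω * ∑ η, rcMass (delW w (barOf Y W)) q η * K W η),
      ind_avoidEv_eq_ite_setCl, hmean, cut_eq_barOf, Finset.mul_sum, Finset.mul_sum, Finset.mul_sum]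
    refine Finset.sum_congr rfl fun η _ => ?_
    simp only [hK, hχ]; ring
  have hR : ∀ ζ, rcMass w q ζ * (ind (avoidEv x Y) ζ *
      ((g (openEdgeCluster ζ x) - wE w q (cut Y ζ) (fun β => g (openEdgeCluster β x))) * ψ (ζ \ cut Y ζ))) =
      ∑ W : Set (Sym2 V), (if setCl ζ Y = W then rcMass w q ζ * K W (ζ \ barOf Y W) else 0) := by
    intro ζ
    rw [Fintype.sum_ite_eq (setCl ζ Y) (fun W => rcMass w q ζ * K W (ζ \ barOf Y W)), ind_avoidEv_eq_ite_setCl, hmean,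
      cut_eq_barOf]
    simp only [hK, hχ]
    by_cases h : (x ∈ Y ∨ ∃ e ∈ setCl ζ Y, x ∈ e)
    · simp only [if_pos h, zero_mul, mul_zero]
    · have hζ : ζ ∈ avoidEv x Y := (CSH.mem_avoidEv_iff_notMem_span x Y ζ).2 h
      have hco := CSH.openEdgeCluster_sdiff_cut_of_avoid hζ
      rw [cut_eq_barOf] at hco
      rw [if_neg h, hco]
  rw [Finset.sum_congr rfl fun ω _ => hL ω, Finset.sum_congr rfl fun ζ _ => hR ζ, Finset.sum_comm]
  conv_rhs => rw [Finset.sum_comm]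
  refine Finset.sum_congr rfl fun W _ => ?_
  -- class `W`: rc Lemma 2.3
  have key := rcMass_sum_setCl_eq w hq Y W (K W)
  rw [key]
  have e1 : ∑ ω, (if setCl ω Y = W then rcMass w q ω * ∑ η, rcMass (delW w (barOf Y W)) q η * K W η else 0) =
      (∑ ω, (if setCl ω Y = W then rcMass w q ω else 0)) * ∑ η, rcMass (delW w (barOf Y W)) q η * K W η := by
    rw [Finset.sum_mul]
    refine Finset.sum_congr rfl fun ω _ => ?_
    split_ifs <;> simp
  rw [e1]

/-- **`C_Y`-measurable terms vanish against the residual, for `φ_{w,q}`** (`q > 0`): for any function `κ` of the cluster of `Y`,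
`Σ_ζ m(ζ) 1_D(ζ) κ(C_Y ζ) (g(C_x ζ) − ḡ(ζ)) = 0` (`CSH.residual_orthogonal` for the random-cluster measure; rc Lemma 2.3 class by class).
[cite: VandenbergHaggstromKahn2005, §2.1 Lemma 2.3–2.4 (p. 10) — corollary] -/
theorem residual_orthogonal_rc (w : Sym2 V → unitInterval) {q : ℝ} (hq : 0 < q) (x : V) (Y : Set V) (g : Set (Sym2 V) → ℝ)
    (κ : Set (Sym2 V) → ℝ) :
    ∑ ζ, rcMass w q ζ * (ind (avoidEv x Y) ζ * (κ (setCl ζ Y) *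
      (g (openEdgeCluster ζ x) - wE w q (cut Y ζ) (fun β => g (openEdgeCluster β x))))) = 0 := by
  classical
  set G : Set (Sym2 V) → ℝ := fun β => g (openEdgeCluster β x) with hG
  set mW : Set (Sym2 V) → ℝ := fun W => wE w q (barOf Y W) G with hmW
  set χ : Set (Sym2 V) → ℝ := fun W => if (x ∈ Y ∨ ∃ e ∈ W, x ∈ e) then 0 else 1 with hχ
  have hmean : ∀ ζ : Set (Sym2 V), wE w q (cut Y ζ) G = mW (setCl ζ Y) := by
    intro ζ; simp only [hmW, cut_eq_barOf]
  have hterm : ∀ ζ, rcMass w q ζ * (ind (avoidEv x Y) ζ * (κ (setCl ζ Y) * (g (openEdgeCluster ζ x) - wE w q (cut Y ζ) G))) =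
      ∑ W : Set (Sym2 V), (if setCl ζ Y = W then
        χ W * κ W * (rcMass w q ζ * G (ζ \ barOf Y W) - rcMass w q ζ * mW W) else 0) := by
    intro ζ
    rw [Fintype.sum_ite_eq (setCl ζ Y) (fun W => χ W * κ W * (rcMass w q ζ * G (ζ \ barOf Y W) - rcMass w q ζ * mW W)),
      ind_avoidEv_eq_ite_setCl, hmean]
    simp only [hχ]
    by_cases h : (x ∈ Y ∨ ∃ e ∈ setCl ζ Y, x ∈ e)
    · simp only [if_pos h, zero_mul, mul_zero]
    · have hζ : ζ ∈ avoidEv x Y := (CSH.mem_avoidEv_iff_notMem_span x Y ζ).2 h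
      have hco := CSH.openEdgeCluster_sdiff_cut_of_avoid hζ
      rw [cut_eq_barOf] at hco
      rw [if_neg h, show G (ζ \ barOf Y (setCl ζ Y)) = g (openEdgeCluster ζ x) by simp only [hG, hco]]
      ring
  rw [Finset.sum_congr rfl fun ζ _ => hterm ζ, Finset.sum_comm]
  refine Finset.sum_eq_zero fun W _ => ?_
  have key := rcMass_sum_setCl_eq w hq Y W G
  have e1 : ∑ ζ, (if setCl ζ Y = W then χ W * κ W * (rcMass w q ζ * G (ζ \ barOf Y W) - rcMass w q ζ * mW W) else 0) =
      χ W * κ W * ((∑ ζ, (if setCl ζ Y = W then rcMass w q ζ * G (ζ \ barOf Y W) else 0)) -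
        (∑ ζ, (if setCl ζ Y = W then rcMass w q ζ else 0)) * mW W) := by
    rw [mul_sub, Finset.mul_sum, Finset.sum_mul, Finset.mul_sum, ← Finset.sum_sub_distrib]
    refine Finset.sum_congr rfl fun ζ _ => ?_
    split_ifs <;> ring
  rw [e1, key]
  simp only [hmW, wE]
  ring

end FK

end Summit.CriticalPhenomena.PercolationContinuityZ3.Theorems

end
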